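import Literature.Topology.FourManifolds.NullImages
import HarnessLib

/-!
# Generic parameters for a family of affine conditions with three coefficients
# (general position for maps of surfaces: Whitney 1936, §8; Milnor 1965, Lemma 6.12)

Topic `Literature/Topology/FourManifolds`; general-position toolkit, companion of
`NullImages.lean` (two coefficients — the form used for curves and one-parameter families of
curves).  For maps of a **surface** into an `n`-manifold one perturbs, in a chart, by affine terms
`ρ(u) (q₀ + x q₁ + y q₂)` in the two coordinates `x, y` of the plane, with a parameter
`q = (q₀, q₁, q₂) ∈ V × V × V`; the conditions "the perturbed map identifies the pair `(u, u')`"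
and "the perturbed differential kills the direction `v` at `u`" are affine in `q` with three real
coefficients, and the pairs `(u, u')`, resp. `(u, v)`, form a `4`-dimensional family, so that the
bad parameters are null as soon as `4 < n = dim V` — the dimension count `dim M₂ ≥ 2 dim M₁ + 1`
of Whitney's imbedding theorem for `M₁` a surface (Milnor, *Lectures on the h-cobordism theorem*
(1965), Lemma 6.12, PDF p. 42, used on PDF p. 43 for the Whitney disc: *"Applying Lemmas 6.11
and 6.12 to `φ₂'|Int D` we can obtain a smooth imbedding `φ₃ : U → V`"*).

* `Literature.Topology.FourManifolds.addHaar_setOf_exists_smul_add_smul_add_smul_eq` — given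
  coefficient functions `a b c : X → ℝ` and `Δ : X → V`, differentiable on `P ⊆ X`, with
  `dim X < dim V`, the set of parameters `(q₀, q₁, q₂) ∈ V × V × V` for which
  `a p • q₀ + b p • q₁ + c p • q₂ = Δ p` for some `p ∈ P` with `(a p, b p, c p) ≠ 0` is null:
  solving for `q₀`, `q₁` or `q₂` exhibits it as the union of three differentiable images of
  subsets of `X × V × V`, of dimension `< 3 dim V` (the tree's easy Sard,
  `Literature.Topology.FourManifolds.addHaar_image_eq_zero_of_finrank_lt`).

Everything here is proved; no definitions, no named facts.

## References

* H. Whitney, *Differentiable manifolds*, Ann. of Math. (2) 37 (1936), 645–680, §II Thm. 5, §8.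
  [Whitney1936]
* J. Milnor, *Lectures on the h-cobordism theorem* (1965), Lemma 6.12 (PDF p. 42), proof of
  Lemma 6.7 (PDF p. 43). [MilnorHCobordism1965]
* J. Milnor, *Topology from the differentiable viewpoint* (1965), §§2–3. [MilnorTDV1965]
-/

open Set Function Module
open _root_.MeasureTheory _root_.MeasureTheory.Measure

noncomputable section

namespace Literature.Topology.FourManifolds

variable {X : Type*} [NormedAddCommGroup X] [NormedSpace ℝ X] [FiniteDimensional ℝ X]

/-- **Generic parameters for a family of affine conditions with three coefficients.**  Let
`a b c : X → ℝ` and `Δ : X → V` be differentiable on `P ⊆ X`, with `dim X < dim V`.  Then the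
set of `(q₀, q₁, q₂) ∈ V × V × V` such that `a p • q₀ + b p • q₁ + c p • q₂ = Δ p` for some `p ∈ P`
at which `(a p, b p, c p) ≠ (0, 0, 0)` is null for every additive Haar measure on `V × V × V`:
where `a p ≠ 0` the condition reads `q₀ = (a p)⁻¹ • (Δ p - b p • q₁ - c p • q₂)`, and similarly
where `b p ≠ 0` or `c p ≠ 0`, so the set is covered by three differentiable images of subsets of
`X × V × V`, and `dim (X × V × V) < dim (V × V × V)`
(`Literature.Topology.FourManifolds.addHaar_image_eq_zero_of_finrank_lt`).  This is the form in
which "general position" is used for maps of surfaces (Whitney (1936), §8, `m = 2`).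
[folklore] -/
theorem addHaar_setOf_exists_smul_add_smul_add_smul_eq {V : Type*} [NormedAddCommGroup V]
    [NormedSpace ℝ V] [FiniteDimensional ℝ V] [MeasurableSpace V] [BorelSpace V]
    (μ : Measure (V × V × V)) [IsAddHaarMeasure μ] (hXV : finrank ℝ X < finrank ℝ V)
    {P : Set X} {a b c : X → ℝ} {Δ : X → V}
    (ha : DifferentiableOn ℝ a P) (hb : DifferentiableOn ℝ b P) (hc : DifferentiableOn ℝ c P)
    (hΔ : DifferentiableOn ℝ Δ P) :
    μ {q : V × V × V | ∃ p ∈ P, (a p ≠ 0 ∨ b p ≠ 0 ∨ c p ≠ 0) ∧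
      a p • q.1 + b p • q.2.1 + c p • q.2.2 = Δ p} = 0 := by
  have hdim : finrank ℝ (X × V × V) < finrank ℝ (V × V × V) := by
    simp only [finrank_prod]
    omega
  -- the three parametrisations, with parameters `(p, the two other components)`
  set D₁ : Set (X × V × V) := {z | z.1 ∈ P ∧ a z.1 ≠ 0} with hD₁
  set D₂ : Set (X × V × V) := {z | z.1 ∈ P ∧ b z.1 ≠ 0} with hD₂
  set D₃ : Set (X × V × V) := {z | z.1 ∈ P ∧ c z.1 ≠ 0} with hD₃
  set Φ₁ : X × V × V → V × V × V := fun z =>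
    ((a z.1)⁻¹ • (Δ z.1 - b z.1 • z.2.1 - c z.1 • z.2.2), z.2.1, z.2.2) with hΦ₁
  set Φ₂ : X × V × V → V × V × V := fun z =>
    (z.2.1, (b z.1)⁻¹ • (Δ z.1 - a z.1 • z.2.1 - c z.1 • z.2.2), z.2.2) with hΦ₂
  set Φ₃ : X × V × V → V × V × V := fun z =>
    (z.2.1, z.2.2, (c z.1)⁻¹ • (Δ z.1 - a z.1 • z.2.1 - b z.1 • z.2.2)) with hΦ₃
  have haf : DifferentiableOn ℝ (fun z : X × V × V => a z.1) (Prod.fst ⁻¹' P) :=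
    ha.comp differentiableOn_fst fun z hz => hz
  have hbf : DifferentiableOn ℝ (fun z : X × V × V => b z.1) (Prod.fst ⁻¹' P) :=
    hb.comp differentiableOn_fst fun z hz => hz
  have hcf : DifferentiableOn ℝ (fun z : X × V × V => c z.1) (Prod.fst ⁻¹' P) :=
    hc.comp differentiableOn_fst fun z hz => hz
  have hΔf : DifferentiableOn ℝ (fun z : X × V × V => Δ z.1) (Prod.fst ⁻¹' P) :=
    hΔ.comp differentiableOn_fst fun z hz => hz
  have h21 : Differentiable ℝ fun z : X × V × V => z.2.1 := differentiable_fst.comp differentiable_snd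
  have h22 : Differentiable ℝ fun z : X × V × V => z.2.2 := differentiable_snd.comp differentiable_snd
  have hD₁P : D₁ ⊆ Prod.fst ⁻¹' P := fun z hz => hz.1
  have hD₂P : D₂ ⊆ Prod.fst ⁻¹' P := fun z hz => hz.1
  have hD₃P : D₃ ⊆ Prod.fst ⁻¹' P := fun z hz => hz.1
  have hΦ₁d : DifferentiableOn ℝ Φ₁ D₁ := by
    refine DifferentiableOn.prodMk ?_ (h21.differentiableOn.prodMk h22.differentiableOn)
    refine DifferentiableOn.smul ((haf.mono hD₁P).inv fun z hz => hz.2) ?_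
    exact ((hΔf.mono hD₁P).sub ((hbf.mono hD₁P).smul h21.differentiableOn)).sub
      ((hcf.mono hD₁P).smul h22.differentiableOn)
  have hΦ₂d : DifferentiableOn ℝ Φ₂ D₂ := by
    refine DifferentiableOn.prodMk h21.differentiableOn (DifferentiableOn.prodMk ?_ h22.differentiableOn)
    refine DifferentiableOn.smul ((hbf.mono hD₂P).inv fun z hz => hz.2) ?_
    exact ((hΔf.mono hD₂P).sub ((haf.mono hD₂P).smul h21.differentiableOn)).sub
      ((hcf.mono hD₂P).smul h22.differentiableOn)
  have hΦ₃d : DifferentiableOn ℝ Φ₃ D₃ := by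
    refine DifferentiableOn.prodMk h21.differentiableOn (DifferentiableOn.prodMk h22.differentiableOn ?_)
    refine DifferentiableOn.smul ((hcf.mono hD₃P).inv fun z hz => hz.2) ?_
    exact ((hΔf.mono hD₃P).sub ((haf.mono hD₃P).smul h21.differentiableOn)).sub
      ((hbf.mono hD₃P).smul h22.differentiableOn)
  have h1 : μ (Φ₁ '' D₁) = 0 := addHaar_image_eq_zero_of_finrank_lt μ hdim hΦ₁d
  have h2 : μ (Φ₂ '' D₂) = 0 := addHaar_image_eq_zero_of_finrank_lt μ hdim hΦ₂d
  have h3 : μ (Φ₃ '' D₃) = 0 := addHaar_image_eq_zero_of_finrank_lt μ hdim hΦ₃d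
  refine measure_mono_null ?_ (measure_union_null (measure_union_null h1 h2) h3)
  rintro ⟨q₀, q₁, q₂⟩ ⟨p, hp, habc, heq⟩
  rcases habc with ha0 | hb0 | hc0
  · refine Or.inl (Or.inl ⟨(p, q₁, q₂), ⟨hp, ha0⟩, ?_⟩)
    simp only [hΦ₁, Prod.mk.injEq, and_true]
    have : Δ p - b p • q₁ - c p • q₂ = a p • q₀ := by rw [← heq]; abel
    rw [this, smul_smul, inv_mul_cancel₀ ha0, one_smul]
  · refine Or.inl (Or.inr ⟨(p, q₀, q₂), ⟨hp, hb0⟩, ?_⟩)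
    simp only [hΦ₂, Prod.mk.injEq, true_and, and_true]
    have : Δ p - a p • q₀ - c p • q₂ = b p • q₁ := by rw [← heq]; abel
    rw [this, smul_smul, inv_mul_cancel₀ hb0, one_smul]
  · refine Or.inr ⟨(p, q₀, q₁), ⟨hp, hc0⟩, ?_⟩
    simp only [hΦ₃, Prod.mk.injEq, true_and]
    have : Δ p - a p • q₀ - b p • q₁ = c p • q₂ := by rw [← heq]; abel
    rw [this, smul_smul, inv_mul_cancel₀ hc0, one_smul]

end Literature.Topology.FourManifolds
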